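import Summits.AtomisticToContinuum.Crystallization.Theorems.FrustratedLawDichotomyCoherentFloorHaloDial
import Summits.AtomisticToContinuum.Crystallization.Theorems.FrustratedLawDichotomyCoherentFloorHaloComplete

/-!
# FrustratedLawDichotomy · crux `AperiodicFrustratedLawGap` (stmt-AtomisticToContinuum-27623) — T2-H WITH DIALLED CLEARANCES ON RADIALLY COMPLETE TEMPLATES
# (the K-file form of the class-H door WITHOUT the radial `hin`; FINDING «TEMPLATE-COMPLETENESS» r1861 (A), KFILE amendment E §E1-H; decomp-a2c hand-1 g55)

The tree's `…CoherentFloorHaloDial` (hand-1 g52) — the dialled class-H door a cell K-file instantiates through `…CellHalo` ((253)) — carries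
`hin : ∀ x ∈ a, ‖x‖ + τ ≤ Rc ∧ ⟪x, n⟫ + τ ≤ s`.  Its RADIAL conjunct together with coherence on the half-window excludes every perturbed full host
half-lattice.  This sibling deletes the radial conjunct (the PLANE conjunct stays: a near template atom beyond the level could have `V_LJ > 0`):
* `norm_sum_template_force_le_halo_dial'` — the dialled force split with NO `hin` at all (template / non-template split of lens-5's
  `…CoherentFloorHaloComplete.norm_sum_template_force_le_halo'`, columns `farCol dB + halfCol dH`);
* ★★★ `certFloorHalo_le_two_mul_rootEnergy_dial'` / `…_dial_of_nash'` — the tree's statements with `hin := ∀ x ∈ a, ⟪x, n⟫ + τ ≤ s`, every column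
  unchanged; the half-window energy EQUALITY is replaced by lens-5's inequality `sum_lennardJones_atomOf_le_setIntegral_halo` (a template atom off the
  half-window is outside the ball, `r > Rc ≥ 1`, `V_LJ ≤ 0`).
DEF-FREE; imports TREE `…CoherentFloorHaloDial` + `…CoherentFloorHaloComplete`; 0 sorry.  All `[folklore]`; nothing here closes an item.
-/

noncomputable section

namespace Summit.AtomisticToContinuum.Crystallization.Theorems.FrustratedLawDichotomyCoherentFloorHaloDialComplete

open MeasureTheory Metric Set Filter RealInnerProductSpace
open scoped BigOperators Topology ENNReal
open Literature.MathematicalPhysics.StatisticalMechanics (lennardJones rootEnergy rootEnergy_def)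
open Literature.Probability.Process (IsRootedHardCore count_restrict_singleton_ne_zero_iff)
open Summit.AtomisticToContinuum.Crystallization.Theorems.ChargedEnergyGapNegative (E3)
open Summit.AtomisticToContinuum.Crystallization.Theorems.FrustratedLawDichotomyCoherentWindow
open Summit.AtomisticToContinuum.Crystallization.Theorems.FrustratedLawDichotomyCoherentOn
open Summit.AtomisticToContinuum.Crystallization.Theorems.FrustratedLawDichotomyFarForceColumn (sum_norm_force_le_sevenTenths
  sum_norm_force_le_sevenTenths_of_far_from_root)
open Summit.AtomisticToContinuum.Crystallization.Theorems.FrustratedLawDichotomyHalfSpaceCapSharp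
  (sum_norm_force_le_of_separated_halfspace_sharp_sevenTenths)
open Summit.AtomisticToContinuum.Crystallization.Theorems.FrustratedLawDichotomyTransportPriceTail (integrable_lennardJones_of_isRootedHardCore)
open Summit.AtomisticToContinuum.Crystallization.Theorems.FrustratedLawDichotomyNashForceBalance (hasSum_force_of_nash)
open Summit.AtomisticToContinuum.Crystallization.Theorems.FrustratedLawDichotomyCoherentFloorAlgebra
open Summit.AtomisticToContinuum.Crystallization.Theorems.FrustratedLawDichotomyCoherentFloor
open Summit.AtomisticToContinuum.Crystallization.Theorems.FrustratedLawDichotomyCoherentFloorHalo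
open Summit.AtomisticToContinuum.Crystallization.Theorems.FrustratedLawDichotomyCoherentFloorHaloComplete (sum_lennardJones_atomOf_le_setIntegral_halo)

/-- ★ THE FORCE-BALANCE SPLIT with DIALLED CLEARANCES and NO `hin` (the tree's `…HaloDial.norm_sum_template_force_le_halo_dial` on a radially
complete template): the balance is split template / non-template (lens-5 `…HaloComplete.norm_sum_template_force_le_halo'`); a non-template atom is
off the half-window, i.e. outside the ball (`farCol dB`, `dB ≤ Rc − (‖x‖+τ)`) or beyond the plane (`halfCol dH`, `dH ≤ s − (⟪x,n⟫+τ)`). [folklore] -/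
theorem norm_sum_template_force_le_halo_dial' {S : Set E3} {τ Rc s : ℝ} {a : Finset E3} {n : E3} (hn : ‖n‖ = 1)
    (hS : ∀ p ∈ S, ∀ p' ∈ S, p ≠ p' → (7 : ℝ) / 10 ≤ dist p p') (hτ : 2 * τ < 7 / 10)
    (hcoh : (Measure.count.restrict S : Measure E3) ∈ coherentOn a τ (haloWindow n s Rc))
    (ha : ∀ x ∈ a, ∀ x' ∈ a, x ≠ x' → 2 * τ < dist x x')
    {x : E3} (hx : x ∈ a) {dB dH : ℝ} (hdB : 7 / 20 ≤ dB) (hdB' : dB ≤ Rc - (‖x‖ + τ)) (hdH : 7 / 20 ≤ dH) (hdH' : dH ≤ s - (⟪x, n⟫ + τ))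
    (hbal : HasSum (fun q : {q : E3 // (Measure.count.restrict S : Measure E3) {q} ≠ 0 ∧ q ≠ atomOf S τ x} =>
      ((dist (atomOf S τ x) (q : E3))⁻¹ ^ 8 - (dist (atomOf S τ x) (q : E3))⁻¹ ^ 14) • (atomOf S τ x - (q : E3))) 0) :
    ‖∑ x' ∈ a.erase x, ljBondForce (atomOf S τ x - atomOf S τ x')‖ ≤ farCol dB + halfCol dH := by
  classical
  have h7 : (0 : ℝ) < 7 / 10 := by norm_num
  have hW := measurableSet_haloWindow n s Rc
  have hne : ∀ z ∈ a, (closedBall z τ ∩ S).Nonempty := fun z hz => nonempty_of_mem_coherentOn hW hcoh hz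
  set p : E3 := atomOf S τ x with hp
  have hpS : p ∈ S := (atomOf_mem (hne x hx)).2
  have hpn : ‖p‖ ≤ ‖x‖ + τ := norm_atomOf_le (hne x hx)
  have hpin : ⟪p, n⟫ ≤ ⟪x, n⟫ + τ := by
    have h1 : ‖p - x‖ ≤ τ := norm_atomOf_sub_le (hne x hx)
    have h2 : ⟪p - x, n⟫ ≤ ‖p - x‖ := by
      have := abs_real_inner_le_norm (p - x) n
      rw [hn, mul_one] at this
      exact (le_abs_self _).trans this
    have h3 : ⟪p, n⟫ = ⟪x, n⟫ + ⟪p - x, n⟫ := by rw [← inner_add_left, add_sub_cancel]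
    linarith
  set T := {q : E3 // (Measure.count.restrict S : Measure E3) {q} ≠ 0 ∧ q ≠ p}
  set f : T → E3 := fun q => ((dist p (q : E3))⁻¹ ^ 8 - (dist p (q : E3))⁻¹ ^ 14) • (p - (q : E3)) with hf
  have hmemT : ∀ q : T, (q : E3) ∈ S ∧ (q : E3) ≠ p := fun q =>
    ⟨(count_restrict_singleton_ne_zero_iff S q).mp q.2.1, q.2.2⟩
  have hdistT : ∀ q : T, (7 : ℝ) / 10 ≤ dist (q : E3) p := fun q => hS _ (hmemT q).1 p hpS (hmemT q).2
  -- the norms are summable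
  have hnorm : Summable fun q : T => ‖f q‖ := by
    refine summable_of_sum_le (fun q => norm_nonneg _) (c := farCol (7 / 10)) fun u => ?_
    have hmap : ∑ q ∈ u, ‖f q‖ =
        ∑ q ∈ u.map (Function.Embedding.subtype _), ‖((dist p q)⁻¹ ^ 8 - (dist p q)⁻¹ ^ 14) • (p - q)‖ := by
      rw [Finset.sum_map]; rfl
    rw [hmap]
    unfold farCol
    refine sum_norm_force_le_sevenTenths _ p (by norm_num) (fun q hq q' hq' hqq' => ?_) (fun q hq => ?_)
    · obtain ⟨w, -, rfl⟩ := Finset.mem_map.mp hq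
      obtain ⟨w', -, rfl⟩ := Finset.mem_map.mp hq'
      exact hS _ (hmemT w).1 _ (hmemT w').1 hqq'
    · obtain ⟨w, -, rfl⟩ := Finset.mem_map.mp hq
      exact hdistT w
  -- the TEMPLATE part of `T`
  set tpl : Finset E3 := (a.erase x).image (atomOf S τ) with htpl
  have hnear : {q : T | (q : E3) ∈ (tpl : Set E3)}.Finite :=
    Finite.of_injOn (f := fun q : T => (q : E3)) (t := (tpl : Set E3)) (fun q hq => hq) Subtype.val_injective.injOn tpl.finite_toSet
  set sW : Finset T := hnear.toFinset with hsW
  have hsplit := hbal.summable.sum_add_tsum_compl (s := sW)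
  rw [hbal.tsum_eq] at hsplit
  have hsum_s : ∑ q ∈ sW, f q = -∑' q : ↑((↑sW : Set T)ᶜ), f q := eq_neg_of_add_eq_zero_left hsplit
  -- complement points are not template atoms, hence off the half-window: outside the ball or beyond the plane
  have hout : ∀ q : ↑((↑sW : Set T)ᶜ), ((q : T) : E3) ∉ haloWindow n s Rc := fun q hqW => by
    have h1 : (q : T) ∉ (↑sW : Set T) := q.2
    have h2 : (q : T) ∉ hnear.toFinset := h1
    rw [Finite.mem_toFinset] at h2
    have h3 : ((q : T) : E3) ∉ (tpl : Set E3) := h2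
    obtain ⟨x', hx', hqx'⟩ := inter_subset_image_atomOf_of_coherentOn hS hτ hW hcoh ⟨(hmemT q).1, hqW⟩
    have hx'a : x' ∈ a := hx'
    by_cases hxx : x' = x
    · exact (hmemT q).2 (by rw [← hqx', hxx])
    · exact h3 (by rw [htpl, Finset.coe_image]; exact ⟨x', Finset.mem_coe.mpr (Finset.mem_erase.mpr ⟨hxx, hx'a⟩), hqx'⟩)
  have hnormc : Summable fun q : ↑((↑sW : Set T)ᶜ) => ‖f q‖ := hnorm.subtype _
  have htail : ∑' q : ↑((↑sW : Set T)ᶜ), ‖f q‖ ≤ farCol dB + halfCol dH := by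
    refine hnormc.tsum_le_of_sum_le fun u => ?_
    set emb : ↑((↑sW : Set T)ᶜ) ↪ E3 := ⟨fun q => ((q : T) : E3), fun q q' hqq' => Subtype.ext (Subtype.ext hqq')⟩ with hemb
    have hmap : ∑ q ∈ u, ‖f q‖ = ∑ q ∈ u.map emb, ‖((dist p q)⁻¹ ^ 8 - (dist p q)⁻¹ ^ 14) • (p - q)‖ := by
      rw [Finset.sum_map]; rfl
    rw [hmap]
    set v := u.map emb with hv
    have hvS : ∀ q ∈ v, q ∈ S ∧ q ∉ haloWindow n s Rc := fun q hq => by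
      obtain ⟨w, -, rfl⟩ := Finset.mem_map.mp hq
      exact ⟨(hmemT w).1, hout w⟩
    have hvsep : ∀ q ∈ v, ∀ q' ∈ v, q ≠ q' → (7 : ℝ) / 10 ≤ dist q q' := fun q hq q' hq' hqq' =>
      hS q (hvS q hq).1 q' (hvS q' hq').1 hqq'
    rw [← Finset.sum_filter_add_sum_filter_not v (fun q => q ∈ closedBall (0 : E3) Rc)]
    have hA : ∑ q ∈ v.filter (fun q => ¬ q ∈ closedBall (0 : E3) Rc), ‖((dist p q)⁻¹ ^ 8 - (dist p q)⁻¹ ^ 14) • (p - q)‖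
        ≤ farCol dB := by
      have hρ : dist p 0 ≤ Rc - dB := by rw [dist_zero_right]; linarith
      have hR' : 7 / 20 ≤ Rc - (Rc - dB) := by linarith
      have h := sum_norm_force_le_sevenTenths_of_far_from_root (v.filter (fun q => ¬ q ∈ closedBall (0 : E3) Rc)) p 0 hρ hR'
        (fun q hq q' hq' hqq' => hvsep q (Finset.mem_filter.mp hq).1 q' (Finset.mem_filter.mp hq').1 hqq') (fun q hq => ?_)
      · have e : Rc - (Rc - dB) = dB := by ring
        rw [e] at h
        unfold farCol
        exact h
      have h := (Finset.mem_filter.mp hq).2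
      rw [mem_closedBall, not_le] at h
      exact h.le
    have hB : ∑ q ∈ v.filter (fun q => q ∈ closedBall (0 : E3) Rc), ‖((dist p q)⁻¹ ^ 8 - (dist p q)⁻¹ ^ 14) • (p - q)‖
        ≤ halfCol dH := by
      unfold halfCol
      refine sum_norm_force_le_of_separated_halfspace_sharp_sevenTenths _ p n hn hdH
        (fun q hq q' hq' hqq' => hvsep q (Finset.mem_filter.mp hq).1 q' (Finset.mem_filter.mp hq').1 hqq') (fun q hq => ?_)
      obtain ⟨hqv, hqball⟩ := Finset.mem_filter.mp hq
      have hq2 : ¬ ⟪q, n⟫ ≤ s := fun h => (hvS q hqv).2 ⟨hqball, h⟩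
      rw [inner_sub_left]
      linarith [not_le.mp hq2]
    linarith
  -- the template part of the balance is the template sum
  have hmapS : sW.map (Function.Embedding.subtype _) = tpl := by
    ext q
    rw [Finset.mem_map]
    constructor
    · rintro ⟨w, hw, rfl⟩
      rw [hsW, Finite.mem_toFinset] at hw
      exact hw
    · intro hq
      have hq' := hq
      rw [htpl, Finset.mem_image] at hq'
      obtain ⟨x', hx', rfl⟩ := hq'
      have hx'a := Finset.mem_of_mem_erase hx'
      have hm := atomOf_mem (hne x' hx'a)
      have hneq : atomOf S τ x' ≠ p := fun h =>
        Finset.ne_of_mem_erase hx' ((injOn_atomOf ha hne) hx'a hx h)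
      refine ⟨⟨atomOf S τ x', (count_restrict_singleton_ne_zero_iff S _).mpr hm.2, hneq⟩, ?_, rfl⟩
      rw [hsW, Finite.mem_toFinset]
      exact hq
  have hwin : ∑ q ∈ sW, f q = ∑ x' ∈ a.erase x, ljBondForce (p - atomOf S τ x') :=
    calc ∑ q ∈ sW, f q = ∑ q ∈ sW.map (Function.Embedding.subtype _), ((dist p q)⁻¹ ^ 8 - (dist p q)⁻¹ ^ 14) • (p - q) := by
          rw [Finset.sum_map]; rfl
      _ = ∑ q ∈ (a.erase x).image (atomOf S τ), ((dist p q)⁻¹ ^ 8 - (dist p q)⁻¹ ^ 14) • (p - q) := by rw [hmapS]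
      _ = ∑ x' ∈ a.erase x, ((dist p (atomOf S τ x'))⁻¹ ^ 8 - (dist p (atomOf S τ x'))⁻¹ ^ 14) • (p - atomOf S τ x') :=
          Finset.sum_image fun x₁ h₁ x₂ h₂ h =>
            (injOn_atomOf ha hne) (Finset.mem_of_mem_erase h₁) (Finset.mem_of_mem_erase h₂) h
      _ = ∑ x' ∈ a.erase x, ljBondForce (p - atomOf S τ x') := Finset.sum_congr rfl fun x' _ => force_eq_ljBondForce _ _
  rw [← hwin, hsum_s, norm_neg]
  exact (norm_tsum_le_tsum_norm hnormc).trans htail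

/-- ★★★ **T2-H WITH DIALLED CLEARANCES, WITHOUT THE RADIAL `hin`** (the tree's `…HaloDial.certFloorHalo_le_two_mul_rootEnergy_dial` on a radially
COMPLETE template): `hin` weakened to its PLANE conjunct `∀ x ∈ a, ⟪x, n⟫ + τ ≤ s`; every column unchanged.  Window energy by lens-5's
`sum_lennardJones_atomOf_le_setIntegral_halo` (a template atom off the half-window is outside the ball, `V_LJ ≤ 0`). [folklore] -/
theorem certFloorHalo_le_two_mul_rootEnergy_dial' {S : Set E3} {τ Rc s : ℝ} {a I : Finset E3} {n : E3} (y : E3 → E3) (dB dH : E3 → ℝ)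
    (hn : ‖n‖ = 1) (hs : 1 ≤ s)
    (hS : ∀ p ∈ S, ∀ p' ∈ S, p ≠ p' → (7 : ℝ) / 10 ≤ dist p p') (h0S : (0 : E3) ∈ S)
    (hτ0 : 0 ≤ τ) (hτ : 2 * τ < 7 / 10) (hRc : 1 ≤ Rc)
    (hcoh : (Measure.count.restrict S : Measure E3) ∈ coherentOn a τ (haloWindow n s Rc))
    (h0a : (0 : E3) ∈ a) (hIa : I ⊆ a) (ha : ∀ x ∈ a, ∀ x' ∈ a, x ≠ x' → 2 * τ < dist x x')
    (hin : ∀ x ∈ a, ⟪x, n⟫ + τ ≤ s) (hI : ∀ x ∈ I, (7 / 20 ≤ dB x ∧ dB x ≤ Rc - (‖x‖ + τ)) ∧ (7 / 20 ≤ dH x ∧ dH x ≤ s - (⟪x, n⟫ + τ)))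
    (hbal : ∀ x ∈ I, HasSum (fun q : {q : E3 // (Measure.count.restrict S : Measure E3) {q} ≠ 0 ∧ q ≠ atomOf S τ x} =>
      ((dist (atomOf S τ x) (q : E3))⁻¹ ^ 8 - (dist (atomOf S τ x) (q : E3))⁻¹ ^ 14) • (atomOf S τ x - (q : E3))) 0) :
    ∑ x ∈ a.erase 0, (phiT (‖x‖ ^ 2) - (τ ^ 2 * secondNeg ‖x‖ + energyRem ‖x‖ τ))
        - τ * ∑ z ∈ a.erase 0, ‖psiT (‖z‖ ^ 2) • z - certCoeff a I y z‖
        - ∑ x ∈ I, ⟪y x, ∑ x' ∈ a.erase x, ljBondForce (x - x')⟫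
        - ∑ x ∈ I, ‖y x‖ * (farCol (dB x) + halfCol (dH x))
        - 1 / 2 * ∑ x ∈ a, ∑ x' ∈ a.erase x, ‖mulExt I y x - mulExt I y x'‖ * forceRem ‖x - x'‖ (dispB τ x + dispB τ x')
        - tailCol Rc - halfEnergyCol s
      ≤ 2 * rootEnergy lennardJones (Measure.count.restrict S : Measure E3) := by
  classical
  have h7 : (0 : ℝ) < 7 / 10 := by norm_num
  have hW := measurableSet_haloWindow n s Rc
  have hne : ∀ z ∈ a, (closedBall z τ ∩ S).Nonempty := fun z hz => nonempty_of_mem_coherentOn hW hcoh hz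
  -- the displacement field of the coherent window
  set d : E3 → E3 := fun z => atomOf S τ z - z with hd
  have hq : ∀ z, z + d z = atomOf S τ z := fun z => by
    show z + (atomOf S τ z - z) = atomOf S τ z
    abel
  have hd0 : d 0 = 0 := by
    have h := atomOf_zero hS hτ h0S hτ0
    show atomOf S τ 0 - 0 = 0
    rw [h, sub_zero]
  have hdτ : ∀ z ∈ a, ‖d z‖ ≤ τ := fun z hz => norm_atomOf_sub_le (hne z hz)
  have hdisp : ∀ z ∈ a, ‖d z‖ ≤ dispB τ z := fun z hz => by
    unfold dispB
    split_ifs with h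
    · rw [h, hd0, norm_zero]
    · exact hdτ z hz
  have hdispτ : ∀ z : E3, dispB τ z ≤ τ := fun z => by unfold dispB; split_ifs <;> linarith
  -- (i) energy slots
  have heR : ∀ x ∈ a.erase 0,
      phiT (‖x‖ ^ 2) + psiT (‖x‖ ^ 2) * ⟪x, d x⟫ - (τ ^ 2 * secondNeg ‖x‖ + energyRem ‖x‖ τ) ≤ phiT (‖x + d x‖ ^ 2) := by
    intro x hx
    obtain ⟨hx0, hxa⟩ := Finset.mem_erase.mp hx
    have hxτ : τ < ‖x‖ := by
      have h := ha x hxa 0 h0a hx0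
      rw [dist_zero_right] at h
      linarith
    exact phiT_taylor_ge x (d x) (hdτ x hxa) hxτ
  -- (iv) force-remainder slots
  have hfR : ∀ x ∈ I, ∀ x' ∈ a.erase x, ‖ljBondForce ((x + d x) - (x' + d x')) - ljBondForce (x - x') - ljBondForceLin (x - x') (d x - d x')‖
      ≤ forceRem ‖x - x'‖ (dispB τ x + dispB τ x') := by
    intro x hx x' hx'
    obtain ⟨hx'x, hx'a⟩ := Finset.mem_erase.mp hx'
    have hxa := hIa hx
    have e : (x + d x) - (x' + d x') = (x - x') + (d x - d x') := by abel
    rw [e]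
    refine norm_ljBondForce_taylor_le (x - x') (d x - d x') ((norm_sub_le _ _).trans (add_le_add (hdisp x hxa) (hdisp x' hx'a))) ?_
    have h3 := ha x hxa x' hx'a (Ne.symm hx'x)
    rw [dist_eq_norm] at h3
    linarith [hdispτ x, hdispτ x']
  -- (iv, far part) the force balance split, halo form
  have hC : ∀ x ∈ I, ‖∑ x' ∈ a.erase x, ljBondForce ((x + d x) - (x' + d x'))‖ ≤ farCol (dB x) + halfCol (dH x) := by
    intro x hx
    simp_rw [hq]
    exact norm_sum_template_force_le_halo_dial' hn hS hτ hcoh ha (hIa hx) (hI x hx).1.1 (hI x hx).1.2 (hI x hx).2.1 (hI x hx).2.2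
      (hbal x hx)
  have hcore := windowSum_ge a I y d τ (fun x => τ ^ 2 * secondNeg ‖x‖ + energyRem ‖x‖ τ)
    (fun x x' => forceRem ‖x - x'‖ (dispB τ x + dispB τ x')) (fun x => farCol (dB x) + halfCol (dH x))
    hIa hd0 hdτ heR hfR (fun x x' => by rw [norm_sub_rev, add_comm (dispB τ x)]) hC
  beta_reduce at hcore
  -- the energy side: window = template sum, ball beyond the plane ≥ −halfEnergyCol, outside the ball ≥ −tailCol
  have hint := integrable_lennardJones_of_isRootedHardCore h7 ⟨S, h0S, hS, rfl⟩
  have hwin : ∑ x ∈ a.erase 0, phiT (‖x + d x‖ ^ 2) ≤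
      ∫ z in haloWindow n s Rc, lennardJones ‖z‖ ∂(Measure.count.restrict S : Measure E3) := by
    have h1 := sum_lennardJones_atomOf_le_setIntegral_halo hn hS hτ hcoh ha hRc hin
    rw [← Finset.sum_erase_add a _ h0a, atomOf_zero hS hτ h0S hτ0, norm_zero] at h1
    have hV0 : lennardJones 0 = 0 := by unfold lennardJones; simp
    rw [hV0, add_zero] at h1
    calc ∑ x ∈ a.erase 0, phiT (‖x + d x‖ ^ 2) = ∑ x ∈ a.erase 0, lennardJones ‖atomOf S τ x‖ :=
          Finset.sum_congr rfl fun x _ => by rw [lennardJones_eq_phiT, hq]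
      _ ≤ _ := h1
  have htail := (abs_le.mp (abs_setIntegral_compl_lennardJones_le hS hRc)).1
  have hhalf := setIntegral_ball_sdiff_lennardJones_ge (Rc := Rc) hn hs hS
  have hball : ∫ z in closedBall (0 : E3) Rc, lennardJones ‖z‖ ∂(Measure.count.restrict S : Measure E3) =
      (∫ z in haloWindow n s Rc, lennardJones ‖z‖ ∂(Measure.count.restrict S : Measure E3)) +
        ∫ z in closedBall (0 : E3) Rc \ {z : E3 | ⟪z, n⟫ ≤ s}, lennardJones ‖z‖ ∂(Measure.count.restrict S : Measure E3) := by
    rw [haloWindow]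
    exact (integral_inter_add_sdiff (measurableSet_halfSpace n s) hint.integrableOn).symm
  have hE : 2 * rootEnergy lennardJones (Measure.count.restrict S : Measure E3) =
      (∫ z in closedBall (0 : E3) Rc, lennardJones ‖z‖ ∂(Measure.count.restrict S : Measure E3)) +
        ∫ z in (closedBall (0 : E3) Rc)ᶜ, lennardJones ‖z‖ ∂(Measure.count.restrict S : Measure E3) := by
    rw [rootEnergy_def, integral_add_compl measurableSet_closedBall hint]
    ring
  rw [hE, hball]
  linarith

/-- ★★★ **T2-H with dialled clearances under the crux's own clauses, WITHOUT THE RADIAL `hin`** (Nash form). [folklore] -/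
theorem certFloorHalo_le_two_mul_rootEnergy_dial_of_nash' {μ : Measure E3} {τ Rc s : ℝ} {a I : Finset E3} {n : E3} (y : E3 → E3)
    (dB dH : E3 → ℝ) (hn : ‖n‖ = 1) (hs : 1 ≤ s) (hμ : IsRootedHardCore (7 / 10) μ)
    (hNash : ∀ p : E3, μ {p} ≠ 0 → ∀ w : E3, (∀ q : E3, μ {q} ≠ 0 → q ≠ p → w ≠ q) →
      ∑' q : {q : E3 // μ {q} ≠ 0 ∧ q ≠ p}, lennardJones (dist p (q : E3)) ≤
        ∑' q : {q : E3 // μ {q} ≠ 0 ∧ q ≠ p}, lennardJones (dist w (q : E3)))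
    (hτ0 : 0 ≤ τ) (hτ : 2 * τ < 7 / 10) (hRc : 1 ≤ Rc) (hcoh : μ ∈ coherentOn a τ (haloWindow n s Rc))
    (h0a : (0 : E3) ∈ a) (hIa : I ⊆ a) (ha : ∀ x ∈ a, ∀ x' ∈ a, x ≠ x' → 2 * τ < dist x x')
    (hin : ∀ x ∈ a, ⟪x, n⟫ + τ ≤ s) (hI : ∀ x ∈ I, (7 / 20 ≤ dB x ∧ dB x ≤ Rc - (‖x‖ + τ)) ∧ (7 / 20 ≤ dH x ∧ dH x ≤ s - (⟪x, n⟫ + τ))) :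
    ∑ x ∈ a.erase 0, (phiT (‖x‖ ^ 2) - (τ ^ 2 * secondNeg ‖x‖ + energyRem ‖x‖ τ))
        - τ * ∑ z ∈ a.erase 0, ‖psiT (‖z‖ ^ 2) • z - certCoeff a I y z‖
        - ∑ x ∈ I, ⟪y x, ∑ x' ∈ a.erase x, ljBondForce (x - x')⟫
        - ∑ x ∈ I, ‖y x‖ * (farCol (dB x) + halfCol (dH x))
        - 1 / 2 * ∑ x ∈ a, ∑ x' ∈ a.erase x, ‖mulExt I y x - mulExt I y x'‖ * forceRem ‖x - x'‖ (dispB τ x + dispB τ x')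
        - tailCol Rc - halfEnergyCol s
      ≤ 2 * rootEnergy lennardJones μ := by
  obtain ⟨S, h0S, hS, rfl⟩ := hμ
  have hW := measurableSet_haloWindow n s Rc
  have hne : ∀ z ∈ a, (closedBall z τ ∩ S).Nonempty := fun z hz => nonempty_of_mem_coherentOn hW hcoh hz
  refine certFloorHalo_le_two_mul_rootEnergy_dial' y dB dH hn hs hS h0S hτ0 hτ hRc hcoh h0a hIa ha hin hI fun x hx => ?_
  have hp : (Measure.count.restrict S : Measure E3) {atomOf S τ x} ≠ 0 :=
    (count_restrict_singleton_ne_zero_iff S _).mpr (atomOf_mem (hne x (hIa hx))).2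
  exact hasSum_force_of_nash (by norm_num : (0 : ℝ) < 7 / 10) ⟨S, h0S, hS, rfl⟩ hp (hNash _ hp)

end Summit.AtomisticToContinuum.Crystallization.Theorems.FrustratedLawDichotomyCoherentFloorHaloDialComplete

end
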